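import Summits.HubbardSuperconductivity.HubbardLadder.Links
import Summits.HubbardSuperconductivity.HubbardSuperconductivity.Theorems.BirGroundStateAverageLRO.Negative.PairGapTower
import Literature.MathematicalPhysics.QuantumLattice.TorusPairSusceptibility
import HarnessLib

/-!
# Rung R4⁻ — the ENERGY-ONLY route: pair incompressibility (a pair charge gap uniform in `L`)
excludes `d_{x²-y²}` pair-field order (Tasaki–Watanabe), typed for the ladder with every hypothesis
explicit

HONEST FRAMING (page 1): ladder R1–R4 with certified numbers; no claim on H/H₀. This file proves
EDGES (implications) only. Its hypotheses — a pair charge gap of the pure Hubbard model at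
`(U, δ) = (8, 1/8)` bounded below uniformly in the side `L`, or the weaker divergence of
`L² · Δ₂(L)` — are OPEN; nothing here asserts them, no certificate of the kind §6 consumes has been
computed, and at certifiable sides the binding input of the finite-volume form — a certified POSITIVE
pair charge gap, i.e. three sector ground energies bracketed to absolute width `≲ 0.1 t` — is beyond
the cell's engines except by exact diagonalisation at `L = 4` (companion file). The route is a
thermodynamic-limit statement: it says WHAT an energy-only R4⁻ row would have to certify.

The mechanism (in the tree, not restated): for a normalised ground state `ψ` of
`H_L = hubbardTorus 2 L 1 U` in the sector `(N, S^z = 0)`, `Δ_d = pairField dWaveFormFactor L`,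
`E(k) = minEnergyOn H_L (szSector k 0)`,

  `(E(N-2) + E(N+2) - 2E(N)) · ⟨ψ, Δ_d† Δ_d ψ⟩ ≤ C(U) · L²`

(`BirGroundStateAverageLRO.Negative.pairGap_mul_lro_le_of_groundStateInSector`: the own-bottom
double-commutator identity, the variational principle in the sectors `N ∓ 2 ∋ Δ_d ψ, Δ_d† ψ`, and the
tree's graded-locality budgets; Koma–Tasaki 1994 Theorem 2.2 in its charge-sector reading,
Tasaki–Watanabe 2021 eq. (15): `⟨[O,[H,O†]]⟩ ≥ Δ_N ⟨O†O⟩ + μ_N ⟨[O,O†]⟩`). Dividing by `L⁴`: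
`Δ₂(L) · p_d(L; ψ) ≤ C(U)/L²` with `p_d = pairFieldDensity` the R4 order parameter
(`= dWaveOrderParamSq` on even sides, `Links.dWaveOrderParamSq_eq_pairFieldDensity`).

What is proved here (ladder vocabulary, `R3R4Props` / `Targets` / `Links`).
* §1 `pairChargeGap H N L = E_L(N_L - 2) + E_L(N_L + 2) - 2E_L(N_L)` of a family at its filling
  (`= 2 · pairGap`, Lin–Hirsch–Scalapino's pair excitation gap, `pairChargeGap_eq_two_mul_pairGap`).
* §2 The HYPOTHESIS of the route as a certificate type, NOT claimed: `PairChargeGapCert H N`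
  (data `w > 0`, `L₀`, and `w ≤ Δ₂(L)` on every even side `L ≥ L₀` — "pair incompressibility",
  the R4 energy input uniform in `L`), its consequence `(2k)² Δ₂(2k) → ∞` (divergent pair
  stiffness; a compressible phase has `L² Δ₂(L) → 4/χ_c < ∞` instead), and the two cell-posed OPEN
  statements at `(t', U, δ) = (0, 8, 1/8)`: `PairIncompressiblePureU8Eighth` (such a certificate
  exists) and the weaker `DivergentPairStiffnessPureU8Eighth`.
* §3 The finite-size inequality in ladder form: for every `U` and `δ ∈ [0, 1/2]` there is
  `C = C(U) ≥ 0` with `Δ₂(L) · p_d(L; ψ) ≤ C/L²` for every side `L ≥ 4` and every normalised ground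
  state `ψ` of `pureHubbard U L` in the sector `(electronNumber δ L, 0)`
  (`pairChargeGap_mul_pairFieldDensity_le`).
* §4 `PairChargeGapCert (pureHubbard U) (electronNumber δ)` ⇒ a `VanishingPairFieldCeilingCert` with
  the explicit rate `u L = C/(w L²)` (`vanishingCeilingCertOfPairChargeGap`); at `(8, 1/8)`:
  `NoDWaveOrderPureU8Eighth` (cell target H⁻) and the catalogued conjecture
  `PureModelStripeCompetition`; `PairIncompressiblePureU8Eighth → NoDWaveOrderPureU8Eighth`.
* §5 `DivergentPairStiffnessPureU8Eighth` ⇒ `NoDWaveOrderPureU8Eighth` and `PureModelStripeCompetition`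
  (squeeze), and the elementary link `NoDWaveOrderPureU8Eighth → PureModelStripeCompetition`.
* (companion file `PairGapCeilingRows.lean`, same request) the FINITE-VOLUME CERTIFICATE FORM for
  ANY Hermitian `H` on the torus Fock space (the `t–t'` model included): from certified
  sector-energy FLOORS `l₋ ≤ E(N-2)`, `l₊ ≤ E(N+2)`, a CEILING `u ≥ E` on the energy of the
  eigenvector `ψ ∈ szSector N 0`, an upper bound `D` on `Re⟨ψ, (Δ†[H,Δ] - [H,Δ]Δ†) ψ⟩` and a bound
  `K` on `|⟨ψ, ΔΔ† ψ⟩ - ⟨ψ, Δ†Δ ψ⟩|`: `(l₋ + l₊ - 2u) · ⟨ψ, Δ†Δ ψ⟩ ≤ D + |l₊ - u| K`, hence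
  `p_d(L; ψ) ≤ (D + |l₊ - u| K)/(g L⁴)` when the certified gap `g = l₋ + l₊ - 2u` is positive.
  ORDERS OF MAGNITUDE (estimates, NOT certified; no certificate of this kind exists in the cell): at
  `U = 8`, `D + |l₊ - u| K ≈ (30–60) · L²`, so the row reads `p_d ≲ (30–60)/(g L²)`: below Yang's
  kinematic `63/32` once `g L² ≳ 30`, below the `t' = -0.25` side's expected `p_d ~ 10⁻²` only for
  `g L² ≳ 3000–6000` (`L ≳ 60–80` at `g = 1`); and `g > 0` itself asks for THREE sector ground
  energies bracketed to absolute width `≲ 0.1 t` (`≈ 0.2 %` of `|E₀|` at `L = 8`), which no engine of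
  the cell delivers beyond exact diagonalisation at `L = 4`. The tree's analytic constant (norm
  budgets, every state) is `C(8) ≈ 6.6·10⁶`: `p_d ≤ C(8)/(Δ₂ L²)` passes `63/32` only at
  `L ≳ 1800/√Δ₂`. Hence: an R4 (thermodynamic-limit, conditional) edge, not an R3 row.

Design notes. Nothing is restated from the tree: §3 is a repackaging of the BirGroundStateAverageLRO
negative lemma at `a = 1/4`, `m = N - 2` (its bulk window `pairNumber_window`). The commensurability caveat (stripe period versus `L`) and the numerical status of
the hypotheses are recorded in the docstrings of §2; the cell's memo is `pub-hubbard-r3/R4-MEMO.md` §10.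

Sources: H. Tasaki, H. Watanabe, Phys. Rev. B 104 (2021) L180501, arXiv:2105.10692, Theorem (10) and
eqs. (13)–(15), p. 3 "Lattice fermion systems" (`q = 2`); T. Koma, H. Tasaki, J. Stat. Phys. 76 (1994)
745, Theorem 2.2 and §3.4; H. Q. Lin, J. E. Hirsch, D. J. Scalapino, Phys. Rev. B 37 (1988) 7359, §II
eq. (9) (pair gap `Δ`, `pairGap`); M. Qin et al., Phys. Rev. X 10 (2020) 031016, §IV (absence of
superconductivity in the pure model at `1/8`); L. F. Tocchio, A. Montorsi, F. Becca, SciPost Phys. 7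
(2019) 021 (insulating versus metallic stripes at `δ = 1/8`).
-/

noncomputable section

namespace Summit.HubbardSuperconductivity.HubbardLadder

open Matrix Finset Filter Literature.Probability.LatticeModels
open Literature.MathematicalPhysics.QuantumLattice
open Literature.Barriers.HubbardSuperconductivity (PureModelStripeCompetition)
open Summit.HubbardSuperconductivity.HubbardSuperconductivity.Theorems.BirGroundStateAverageLRO.Negative
  (pairGap_mul_lro_le_of_groundStateInSector pairNumber_window)
open scoped ComplexOrder Topology

/-! ## §1 The pair charge gap of a family at its filling -/

/-- The **pair charge gap** of the family `H` at the filling `N` on the side `L`: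
`Δ₂(L) = E_L(N_L - 2) + E_L(N_L + 2) - 2 E_L(N_L)`, `E_L(k) = minEnergyOn (H L) (szSector k 0)` the
ground-state energy of `H L` in the sector `(k, S^z = 0)` (Tasaki–Watanabe's `Δ_N` with `q = 2`;
twice Lin–Hirsch–Scalapino's pair gap). Junk for `N L < 2` (truncated subtraction).
[cite: TasakiWatanabe2021, eq. (3) and p. 3] -/
def pairChargeGap (H : TorusHamiltonianFamily) (N : ℕ → ℕ) (L : ℕ) : ℝ :=
  (H L).minEnergyOn (szSector (N L - 2) 0) + (H L).minEnergyOn (szSector (N L + 2) 0) -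
    2 * (H L).minEnergyOn (szSector (N L) 0)

/-- `Δ₂(L) = 2Δ` with `Δ = pairGap (H L) (N L)` the Lin–Hirsch–Scalapino pair excitation gap of the
tree (`TorusPairSusceptibility`). [cite: LinHirschScalapino1988, §II eq. (9)] -/
theorem pairChargeGap_eq_two_mul_pairGap (H : TorusHamiltonianFamily) (N : ℕ → ℕ) (L : ℕ) :
    pairChargeGap H N L = 2 * pairGap (H L) (N L) := by
  unfold pairChargeGap pairGap
  ring

/-! ## §2 The hypothesis of the route: a pair charge gap certificate (typed, NOT claimed) -/

/-- **Pair charge gap certificate** ("pair incompressibility") for the family `H` at the filling `N`: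
a width `w > 0`, a side `L₀`, and the bound `w ≤ Δ₂(L)` on every even side `L ≥ L₀` — the sector
ground states are charge-gapped against adding AND removing a singlet pair, uniformly in the volume
(an insulator at that density in the criterion "`Δ_N` positive and of order 1"). This is the R4
energy input of the route; NO instance for the Hubbard model is constructed in the tree.
[cite: TasakiWatanabe2021, p. 2 after eq. (3)] -/
structure PairChargeGapCert (H : TorusHamiltonianFamily) (N : ℕ → ℕ) where
  /-- the uniform width -/
  w : ℝ
  w_pos : 0 < w
  /-- the side from which the bound holds -/
  L₀ : ℕ
  bound : ∀ L, L₀ ≤ L → Even L → w ≤ pairChargeGap H N L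

/-- A pair charge gap certificate gives **divergent pair stiffness** along the even tori:
`(2k)² · Δ₂(2k) → ∞` (the weakest energy input the route consumes, §5; a compressible phase with
charge susceptibility `χ_c` has `L² Δ₂(L) → 4/χ_c < ∞` instead).
[cite: TasakiWatanabe2021, discussion after eq. (11)] -/
theorem PairChargeGapCert.tendsto_sq_mul_pairChargeGap {H : TorusHamiltonianFamily} {N : ℕ → ℕ}
    (c : PairChargeGapCert H N) :
    Tendsto (fun k : ℕ => (((2 * k : ℕ) : ℝ)) ^ 2 * pairChargeGap H N (2 * k)) atTop atTop := by
  have hsq : Tendsto (fun k : ℕ => c.w * (((2 * k : ℕ) : ℝ)) ^ 2) atTop atTop := by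
    refine Tendsto.const_mul_atTop c.w_pos ?_
    refine (tendsto_pow_atTop two_ne_zero).comp ?_
    exact tendsto_natCast_atTop_atTop.comp
      (tendsto_atTop_mono (fun k => Nat.le_mul_of_pos_left k two_pos) tendsto_id)
  refine tendsto_atTop_mono' atTop ?_ hsq
  refine eventually_atTop.2 ⟨c.L₀, fun k hk => ?_⟩
  have hle : c.w ≤ pairChargeGap H N (2 * k) := c.bound (2 * k) (by omega) (even_two_mul k)
  have hk0 : (0 : ℝ) ≤ (((2 * k : ℕ) : ℝ)) ^ 2 := by positivity
  calc c.w * (((2 * k : ℕ) : ℝ)) ^ 2 = (((2 * k : ℕ) : ℝ)) ^ 2 * c.w := mul_comm _ _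
    _ ≤ (((2 * k : ℕ) : ℝ)) ^ 2 * pairChargeGap H N (2 * k) :=
        mul_le_mul_of_nonneg_left hle hk0

/-- OPEN (cell-posed HYPOTHESIS of the energy-only R4⁻ route; typed, NOT claimed) — **pair
incompressibility of the pure 2D Hubbard model at `U/t = 8`, hole doping `1/8`**: a pair charge gap
certificate exists, i.e. for some `w > 0` the gap `E(N_L-2) + E(N_L+2) - 2E(N_L)` of
`hubbardTorus 2 L 1 8` at `N_L = 2⌊(7/8)L²/2⌋`, `S^z = 0`, is `≥ w` on every large even torus.
Status: no proof and no certified number at any `L`; numerically the ground state at this point is a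
filled (`λ = 8`) stripe state [Zheng et al. 2017; Qin et al. 2020 §IV], insulating in variational
Monte Carlo [Tocchio–Montorsi–Becca 2019] — which would give a gap at commensurate sides (`8 ∣ L`) —
but metallic / weakly superconducting stripes are also reported, and on sides incommensurate with
the stripe period the clause "every even `L`" is doubtful: the honest form may need a subsequence of
sides, which `NoDWaveOrderPureU8Eighth` (all even sides) does not accommodate. Implies the cell
target H⁻ (`noDWaveOrderPureU8Eighth_of_pairIncompressible`).
[cite: TasakiWatanabe2021, Theorem (10)] [cite: QinEtAl2020, §IV p. 11] [status: open] -/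
@[conjecture] def PairIncompressiblePureU8Eighth : Prop :=
  Nonempty (PairChargeGapCert (pureHubbard 8) (electronNumber (1 / 8)))

/-- OPEN (cell-posed HYPOTHESIS, the weakest form the route consumes; typed, NOT claimed) —
**divergent pair stiffness of the pure 2D Hubbard model at `U/t = 8`, `δ = 1/8`** along the even
tori: `(2k)² · Δ₂(2k) → ∞`. Implied by `PairIncompressiblePureU8Eighth`; false in any compressible
phase (`L² Δ₂ → 4/χ_c`). [cite: TasakiWatanabe2021, discussion after eq. (11)] [status: open] -/
@[conjecture] def DivergentPairStiffnessPureU8Eighth : Prop :=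
  Tendsto (fun k : ℕ => (((2 * k : ℕ) : ℝ)) ^ 2 *
    pairChargeGap (pureHubbard 8) (electronNumber (1 / 8)) (2 * k)) atTop atTop

/-- The certificate hypothesis implies the stiffness hypothesis. [folklore] -/
theorem divergentPairStiffnessPureU8Eighth_of_pairIncompressible (h : PairIncompressiblePureU8Eighth) :
    DivergentPairStiffnessPureU8Eighth := by
  obtain ⟨c⟩ := h
  exact c.tendsto_sq_mul_pairChargeGap

/-! ## §3 The finite-size inequality in ladder form -/

/-- **Pair charge gap × order parameter is `O(1/L²)`** (Koma–Tasaki / Tasaki–Watanabe, the tree's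
`pairGap_mul_lro_le_of_groundStateInSector` at `a = 1/4`, `m = N - 2`, divided by `L⁴`): for every
`U` and `δ ∈ [0, 1/2]` there is `C = C(U) ≥ 0` such that for every side `L ≥ 4` and every normalised
ground state `ψ` of `pureHubbard U L` in the sector `(electronNumber δ L, S^z = 0)`,
`Δ₂(L) · p_d(L; ψ) ≤ C / L²`. [cite: TasakiWatanabe2021, Theorem (10) and eqs. (13)–(15)] -/
theorem pairChargeGap_mul_pairFieldDensity_le (U : ℝ) {δ : ℝ} (hδ0 : 0 ≤ δ) (hδ : δ ≤ 1 / 2) :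
    ∃ C : ℝ, 0 ≤ C ∧ ∀ (L : ℕ), 4 ≤ L → ∀ ψ : Fock (Orb (FermionTorus 2 L)), star ψ ⬝ᵥ ψ = 1 →
      IsGroundStateInSector (pureHubbard U L) (electronNumber δ L) 0 ψ →
      pairChargeGap (pureHubbard U) (electronNumber δ) L * pairFieldDensity L ψ ≤ C / (L : ℝ) ^ 2 := by
  obtain ⟨C, hC0, hC⟩ := pairGap_mul_lro_le_of_groundStateInSector U (1 / 4) (by norm_num)
  refine ⟨C, hC0, fun L hL ψ hψ1 hgs => ?_⟩
  haveI : NeZero L := ⟨by omega⟩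
  obtain ⟨h2N, hlo, hhi⟩ := pairNumber_window L hL hδ0 hδ
  have hN2 : electronNumber δ L - 2 + 2 = electronNumber δ L := Nat.sub_add_cancel h2N
  have hN4 : electronNumber δ L - 2 + 4 = electronNumber δ L + 2 := by
    have := h2N; unfold electronNumber at this ⊢; omega
  have hgs' : IsGroundStateInSector (hubbardTorus 2 L 1 U) (electronNumber δ L - 2 + 2) 0 ψ := by
    rw [hN2]; exact hgs
  have key := hC L (electronNumber δ L - 2) ψ hlo hhi hgs' hψ1
  rw [hN4, hN2] at key
  -- `key : Δ₂(L) · Re⟨ψ, Δ†Δ ψ⟩ ≤ C L²`; divide by `L⁴`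
  obtain ⟨L', rfl⟩ : ∃ L', L = L' + 1 := ⟨L - 1, by omega⟩
  have hL0 : (0 : ℝ) < ((L' + 1 : ℕ) : ℝ) := by positivity
  have hS : pairFieldDensity (L' + 1) ψ =
      (star ψ ⬝ᵥ (((pairField dWaveFormFactor (L' + 1))ᴴ *
        pairField dWaveFormFactor (L' + 1)) *ᵥ ψ)).re / ((L' + 1 : ℕ) : ℝ) ^ 4 := rfl
  rw [hS, ← mul_div_assoc]
  calc pairChargeGap (pureHubbard U) (electronNumber δ) (L' + 1) *
          (star ψ ⬝ᵥ (((pairField dWaveFormFactor (L' + 1))ᴴ *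
            pairField dWaveFormFactor (L' + 1)) *ᵥ ψ)).re / ((L' + 1 : ℕ) : ℝ) ^ 4
        ≤ C * ((L' + 1 : ℕ) : ℝ) ^ 2 / ((L' + 1 : ℕ) : ℝ) ^ 4 :=
          div_le_div_of_nonneg_right key (by positivity)
    _ = C / ((L' + 1 : ℕ) : ℝ) ^ 2 := by
          field_simp

/-! ## §4 Pair incompressibility ⇒ a vanishing ceiling certificate ⇒ the targets -/

/-- **The energy-only R4⁻ certificate.** A pair charge gap certificate of `pureHubbard U` at the
filling `electronNumber δ` (`δ ∈ [0, 1/2]`) yields a `VanishingPairFieldCeilingCert` with the explicit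
rate `u L = C(U)/(w L²)` from the side `max L₀ 4`: `p_d(L; ψ) ≤ C/(w L²)` for every normalised sector
ground state on every even side `L ≥ max L₀ 4`. [cite: TasakiWatanabe2021, Theorem (10)] -/
def vanishingCeilingCertOfPairChargeGap (U : ℝ) {δ : ℝ} (hδ0 : 0 ≤ δ) (hδ : δ ≤ 1 / 2)
    (c : PairChargeGapCert (pureHubbard U) (electronNumber δ)) :
    VanishingPairFieldCeilingCert (pureHubbard U) (electronNumber δ) where
  u L := (pairChargeGap_mul_pairFieldDensity_le U hδ0 hδ).choose / (c.w * (L : ℝ) ^ 2)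
  L₀ := max c.L₀ 4
  tendsto_zero := by
    refine tendsto_const_nhds.div_atTop (Tendsto.const_mul_atTop c.w_pos ?_)
    exact (tendsto_pow_atTop two_ne_zero).comp tendsto_natCast_atTop_atTop
  bound L hL hLe ψ hψ1 hgs := by
    obtain ⟨hC0, hC⟩ := (pairChargeGap_mul_pairFieldDensity_le U hδ0 hδ).choose_spec
    set C := (pairChargeGap_mul_pairFieldDensity_le U hδ0 hδ).choose with hCdef
    have hL4 : 4 ≤ L := le_of_max_le_right hL
    have hgapL : c.w ≤ pairChargeGap (pureHubbard U) (electronNumber δ) L :=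
      c.bound L (le_of_max_le_left hL) hLe
    have key := hC L hL4 ψ hψ1 hgs
    have hp0 : 0 ≤ pairFieldDensity L ψ := pairFieldDensity_nonneg L ψ
    have hL0 : (0 : ℝ) < (L : ℝ) ^ 2 := by
      have : (4 : ℝ) ≤ (L : ℝ) := by exact_mod_cast hL4
      positivity
    rw [le_div_iff₀ (mul_pos c.w_pos hL0)]
    calc pairFieldDensity L ψ * (c.w * (L : ℝ) ^ 2)
        = (c.w * pairFieldDensity L ψ) * (L : ℝ) ^ 2 := by ring
      _ ≤ (pairChargeGap (pureHubbard U) (electronNumber δ) L * pairFieldDensity L ψ) * (L : ℝ) ^ 2 :=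
          mul_le_mul_of_nonneg_right (mul_le_mul_of_nonneg_right hgapL hp0) hL0.le
      _ ≤ C / (L : ℝ) ^ 2 * (L : ℝ) ^ 2 := mul_le_mul_of_nonneg_right key hL0.le
      _ = C := div_mul_cancel₀ C hL0.ne'

/-- **A pair charge gap certificate at `(8, 1/8)` ⇒ the cell target H⁻** `NoDWaveOrderPureU8Eighth`
(every admissible ground-state sequence of the pure model has `dWaveOrderParamSq → 0`), through the
ladder's R4⁻ link `noDWaveOrderPureU8Eighth_of_vanishingCeilingCert`.
[cite: TasakiWatanabe2021, Theorem (10)] -/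
theorem noDWaveOrderPureU8Eighth_of_pairChargeGapCert
    (c : PairChargeGapCert (pureHubbard 8) (electronNumber (1 / 8))) : NoDWaveOrderPureU8Eighth :=
  noDWaveOrderPureU8Eighth_of_vanishingCeilingCert
    (vanishingCeilingCertOfPairChargeGap 8 (by norm_num) (by norm_num) c)

/-- **A pair charge gap certificate at `(8, 1/8)` ⇒ the catalogued open conjecture**
`PureModelStripeCompetition = ¬ HasDWavePairFieldLROAt 8 (1/8)`, through
`pureModelStripeCompetition_of_vanishingCeilingCert`. [cite: QinEtAl2020, §IV p. 11] -/
theorem pureModelStripeCompetition_of_pairChargeGapCert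
    (c : PairChargeGapCert (pureHubbard 8) (electronNumber (1 / 8))) : PureModelStripeCompetition :=
  pureModelStripeCompetition_of_vanishingCeilingCert
    (vanishingCeilingCertOfPairChargeGap 8 (by norm_num) (by norm_num) c)

/-- The typed hypothesis `PairIncompressiblePureU8Eighth` implies the cell target H⁻.
[cite: TasakiWatanabe2021, Theorem (10)] -/
theorem noDWaveOrderPureU8Eighth_of_pairIncompressible (h : PairIncompressiblePureU8Eighth) :
    NoDWaveOrderPureU8Eighth := by
  obtain ⟨c⟩ := h
  exact noDWaveOrderPureU8Eighth_of_pairChargeGapCert c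

/-- The typed hypothesis `PairIncompressiblePureU8Eighth` implies the catalogued conjecture
`PureModelStripeCompetition`. [cite: QinEtAl2020, §IV p. 11] -/
theorem pureModelStripeCompetition_of_pairIncompressible (h : PairIncompressiblePureU8Eighth) :
    PureModelStripeCompetition := by
  obtain ⟨c⟩ := h
  exact pureModelStripeCompetition_of_pairChargeGapCert c

/-! ## §5 The weakest form: divergent pair stiffness ⇒ the targets -/

/-- **The cell target H⁻ implies the catalogued conjecture**: if every admissible ground-state
sequence of the pure model at `(8, 1/8)` has `dWaveOrderParamSq → 0`, then not every such sequence has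
pair-field LRO (`liminf > 0`) — admissible sequences exist (`exists_groundStateSeq_pure`).
[cite: QinEtAl2020, §IV p. 11] -/
theorem pureModelStripeCompetition_of_noDWaveOrderPureU8Eighth (h : NoDWaveOrderPureU8Eighth) :
    PureModelStripeCompetition := by
  intro hAt
  obtain ⟨ψ, hψ⟩ := exists_groundStateSeq_pure 8 (1 / 8) (by norm_num)
  have hT : Tendsto (dWaveOrderParamSq ψ) atTop (𝓝 0) :=
    h (electronNumber (1 / 8)) ψ fun L hL => ⟨rfl, hψ L hL⟩
  have hL : 0 < liminf (fun k => dWaveOrderParamSq ψ k) atTop :=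
    hAt (electronNumber (1 / 8)) ψ fun L hL => ⟨rfl, hψ L hL⟩
  rw [hT.liminf_eq] at hL
  exact lt_irrefl _ hL

/-- **Divergent pair stiffness at `(8, 1/8)` ⇒ the cell target H⁻.** If `(2k)² Δ₂(2k) → ∞` then
for every admissible ground-state sequence `0 ≤ dWaveOrderParamSq ψ k ≤ C(8)/((2k)² Δ₂(2k)) → 0`
(§3 at `L = 2k ≥ 4`, once `(2k)² Δ₂(2k) ≥ 1`). [cite: TasakiWatanabe2021, discussion after eq. (11)] -/
theorem noDWaveOrderPureU8Eighth_of_divergentPairStiffness (h : DivergentPairStiffnessPureU8Eighth) :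
    NoDWaveOrderPureU8Eighth := by
  intro N ψ hNψ
  obtain ⟨C, hC0, hC⟩ :=
    pairChargeGap_mul_pairFieldDensity_le 8 (δ := 1 / 8) (by norm_num) (by norm_num)
  have hψ : ∀ L, Even L → star (ψ L) ⬝ᵥ ψ L = 1 ∧
      IsGroundStateInSector (pureHubbard 8 L) (electronNumber (1 / 8) L) 0 (ψ L) := by
    intro L hL
    obtain ⟨hN, h1, hgs⟩ := hNψ L hL
    rw [hN] at hgs
    exact ⟨h1, hgs⟩
  have hT : Tendsto (fun k : ℕ => (((2 * k : ℕ) : ℝ)) ^ 2 *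
      pairChargeGap (pureHubbard 8) (electronNumber (1 / 8)) (2 * k)) atTop atTop := h
  have hg1 : ∀ᶠ k in atTop, (1 : ℝ) ≤ (((2 * k : ℕ) : ℝ)) ^ 2 *
      pairChargeGap (pureHubbard 8) (electronNumber (1 / 8)) (2 * k) := (tendsto_atTop.1 hT) 1
  have hlim : Tendsto (fun k : ℕ => C / ((((2 * k : ℕ) : ℝ)) ^ 2 *
      pairChargeGap (pureHubbard 8) (electronNumber (1 / 8)) (2 * k))) atTop (𝓝 0) :=
    tendsto_const_nhds.div_atTop hT
  refine squeeze_zero' ?_ ?_ hlim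
  · refine eventually_atTop.2 ⟨1, fun k hk => ?_⟩
    rw [dWaveOrderParamSq_eq_pairFieldDensity ψ hk]
    exact pairFieldDensity_nonneg _ _
  · filter_upwards [hg1, eventually_ge_atTop 2] with k hk1 hk2
    have hL4 : 4 ≤ 2 * k := by omega
    rw [dWaveOrderParamSq_eq_pairFieldDensity ψ (by omega : 1 ≤ k)]
    have key := hC (2 * k) hL4 (ψ (2 * k)) (hψ (2 * k) (even_two_mul k)).1
      (hψ (2 * k) (even_two_mul k)).2
    have hgpos : (0 : ℝ) < (((2 * k : ℕ) : ℝ)) ^ 2 *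
        pairChargeGap (pureHubbard 8) (electronNumber (1 / 8)) (2 * k) := lt_of_lt_of_le one_pos hk1
    have hL0 : (0 : ℝ) < (((2 * k : ℕ) : ℝ)) ^ 2 := by positivity
    rw [le_div_iff₀ hgpos]
    calc pairFieldDensity (2 * k) (ψ (2 * k)) *
          ((((2 * k : ℕ) : ℝ)) ^ 2 * pairChargeGap (pureHubbard 8) (electronNumber (1 / 8)) (2 * k))
        = (pairChargeGap (pureHubbard 8) (electronNumber (1 / 8)) (2 * k) *
            pairFieldDensity (2 * k) (ψ (2 * k))) * (((2 * k : ℕ) : ℝ)) ^ 2 := by ring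
      _ ≤ C / (((2 * k : ℕ) : ℝ)) ^ 2 * (((2 * k : ℕ) : ℝ)) ^ 2 :=
          mul_le_mul_of_nonneg_right key hL0.le
      _ = C := div_mul_cancel₀ C hL0.ne'

/-- Divergent pair stiffness at `(8, 1/8)` ⇒ the catalogued conjecture `PureModelStripeCompetition`.
[cite: QinEtAl2020, §IV p. 11] -/
theorem pureModelStripeCompetition_of_divergentPairStiffness (h : DivergentPairStiffnessPureU8Eighth) :
    PureModelStripeCompetition :=
  pureModelStripeCompetition_of_noDWaveOrderPureU8Eighth
    (noDWaveOrderPureU8Eighth_of_divergentPairStiffness h)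

end Summit.HubbardSuperconductivity.HubbardLadder
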